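import Mathlib
import HarnessLib
import Summits.HubbardSuperconductivity.HubbardSuperconductivity.Theorems.KLProgrammeMatsubaraSliceBubbleSignBlind
import Summits.HubbardSuperconductivity.HubbardSuperconductivity.Theorems.KLProgrammeKLRegimeSplitThermalLayerExt
import Summits.HubbardSuperconductivity.HubbardSuperconductivity.Theorems.KLProgrammeMatsubaraHarmonicSums

/-!
# Route `KLProgramme` — crux K3, ENGINE child gen 6 (stmt-HubbardSuperconductivity-20236 `KLRegimeEngineV16`), stub `stub_engine_step_values`,
# (E2-v10) ph-loop inputs on the product carrier `S × F`: the SIGN-BLIND slice ⊗ SOFT-partner bubble, UNIFORMLY IN β AND IN THE FREQUENCY TRANSFER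
# (cell gate-hubbard-kl, seat hubbard-kl-k3c2-p2 g7; answers k3c1-p1 g6's ask HOME/STATUS 2026-08-27T08:33:48Z)

WHY.  In the continuous (E2) organisation (k3c1-p1, `klws_source_split`) the particle–hole loops of the within-slice source carry the line pair
`(Ċ_Λ, D_Λ)`: one SLICE-type line (inner radius, window `[Λ/2, 4Λ]`, sup `2M_f/Λ`) and one SOFT line `D_Λ = C^K_{≤Λ}` — which has NO inner radius:
its propagator `d(s′)·(ik₀′+e′)/s′` is bounded only by `M′/√s′`, and on the Matsubara lattice `√s′` can be as small as `π/β`.  At a general entry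
`(x, y) ∈ (S×F)²` the loop carries the frequency transfer `q₀ = ω − ω′ ∈ (2π/β)ℤ`, so the partner is read at `ω_i + q₀`: the sup × count bound of
`klsb2_slice_bubble_signblind_norm_le` (partner sup `A′`) is then NOT uniform in β for `Λ/8 < |q₀| < 8Λ`.  The uniform statement holds nevertheless:
integrate the partner over the ray variable `e` FIRST (`∫_{|e|<R} de/√(ν² + (e+σ(e))²) ≤ 8√2·√R/√|ν|` for a `½`-Lipschitz energy shift `σ`, `…MatsubaraHarmonicSums` §1) and
then sum `1/√|ν_i|` over the shifted fermionic lattice (`Σ_{i∈I} 1/√|2m_i+1| ≤ 2√(2#I)` for injective integer labels, `…HarmonicSums` §2) — a convergent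
`p = ½` series instead of a harmonic one.  Result: **`klhs_slice_soft_signblind_norm_le`** —
`‖β⁻¹ • Σ_i ∫ Φ_f(ω_i,e)·G_i(e) de‖ ≤ (512/π)·M_f·B` whenever `‖G_i(e)‖ ≤ B/√(ν_i² + (e + σ_i(e))²)` on the window `|e| < 4Λ_n`,
`ν_i = π(2(n_i + m₀) + 1)/β` (`n_i = matsubaraInt`, any integer shift `m₀`, i.e. any BOSONIC frequency transfer `q₀ = 2πm₀/β`), each `σ_i`
`½`-Lipschitz; `n ≤ n_β + 1`, `β ≥ klBetaMin`, any `M`.  The reading `G_i = W_i·Ψ_i` (vertex weight `‖W_i‖ ≤ B_W`, possibly FREQUENCY-DEPENDENT, times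
the soft propagator `‖Ψ_i(e)‖ ≤ M′/√s′`) is **`klhs_slice_soft_signblind_norm_le_mul`**: `≤ (512/π)·M_f·M′·B_W` — the same size as the slice ⊗ slice
pair `klsb2_slice_bubble_signblind_pair_norm_le`, uniformly in β, n ≤ n_β+1, M, the transfer `m₀` and the partner band.
Large transfer: **`klhs_slice_soft_signblind_decay_le`** (`8Λ_n ≤ |q₀|` ⇒ `≤ (512/π)·M_f·B·Λ_n/|q₀|`, sup × count with `|ν_i| ≥ |q₀|/2`) and the
combined FREQUENCY PROFILE **`klhs_slice_soft_signblind_profile_le`** (`m₀ ≠ 0` ⇒ `≤ (512/π)·M_f·B·min(1, 8Λ_n/|q₀|)`).  Regimes by name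
(HOME/STATUS k3c2-p2 g7 08:47Z): `|q₀|, δ ≤ Λ/8` — the cut device `klfp_*` (ZS forms); any bosonic `q₀` — this file.

Pure analysis (finite sums and one-variable integrals); nothing about the model's effective action is asserted; nothing asserts superconductivity.
-/

noncomputable section

namespace Summit.HubbardSuperconductivity.HubbardSuperconductivity.Theorems.KLRegimeSplit

set_option linter.dupNamespace false -- summit = problem name (single-conjunct summit), D-0017

open Real Set MeasureTheory Complex Literature.MathematicalPhysics.QuantumLattice Literature.Probability.LatticeModels
open Summit.HubbardSuperconductivity.HubbardSuperconductivity.Theorems.KLProgrammeLegKernels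

/-! ## The sign-blind slice ⊗ soft-partner bubble, uniformly in β and in the (bosonic) frequency transfer -/

section Bubble

variable {E : Type*} [NormedAddCommGroup E] [NormedSpace ℝ E]

/-- One slice with a NON-constant majorant: `‖h(e)‖ ≤ b(e)` for `|e| < r`, `h(e) = 0` for `|e| ≥ r`, `b ≥ 0` continuous ⇒ `‖∫ h‖ ≤ ∫_{-r}^{r} b`. -/
theorem klhs_norm_integral_le_intervalIntegral {h : ℝ → E} {b : ℝ → ℝ} {r : ℝ} (hr : 0 ≤ r) (hb : Continuous b) (hb0 : ∀ e, 0 ≤ b e)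
    (hbd : ∀ e, |e| < r → ‖h e‖ ≤ b e) (hzero : ∀ e, r ≤ |e| → h e = 0) :
    ‖∫ e, h e‖ ≤ ∫ e in (-r)..r, b e := by
  have hbound : ∀ e : ℝ, ‖h e‖ ≤ Set.indicator (Set.Icc (-r) r) b e := by
    intro e
    by_cases he : e ∈ Set.Icc (-r) r
    · rw [Set.indicator_of_mem he]
      by_cases he' : |e| < r
      · exact hbd e he'
      · rw [hzero e (not_lt.mp he'), norm_zero]; exact hb0 e
    · rw [Set.indicator_of_notMem he, hzero e (klsp_le_abs_of_not_mem_Icc he), norm_zero]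
  have hint : Integrable (Set.indicator (Set.Icc (-r) r) b) :=
    (hb.integrableOn_Icc (a := -r) (b := r)).integrable_indicator measurableSet_Icc
  calc ‖∫ e, h e‖ ≤ ∫ e, Set.indicator (Set.Icc (-r) r) b e := norm_integral_le_of_norm_le hint (Filter.Eventually.of_forall hbound)
    _ = ∫ e in Set.Icc (-r) r, b e := integral_indicator measurableSet_Icc
    _ = ∫ e in (-r)..r, b e := by
        rw [intervalIntegral.integral_of_le (by linarith), integral_Icc_eq_integral_Ioc]

end Bubble

section Model

variable {f : ℝ → ℂ} {Mf : ℝ}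

/-- **THE SIGN-BLIND SLICE ⊗ SOFT-PARTNER BUBBLE, β-UNIFORM.**  Data: the slice-`n` weight `f` (`‖f‖ ≤ M_f`, `f(s) = 0` for `s ≤ (Λ_n/2)²` and for
`s ≥ (4Λ_n)²`); `β ≥ klBetaMin`, `n ≤ n_β + 1`, any Matsubara cutoff `M`; an integer frequency shift `m₀` (the BOSONIC transfer `q₀ = 2πm₀/β`), so the
partner frequencies are `ν_i = π(2(n_i + m₀) + 1)/β`; for every `i` a `½`-Lipschitz energy shift `σ_i` (the partner band along the ray minus `e`);
and factors `G_i : ℝ → ℂ` (vertex weights × soft propagator, frequency-dependent allowed) with `‖G_i(e)‖ ≤ B/√(ν_i² + (e + σ_i(e))²)` for `|e| < 4Λ_n`.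
Then `‖β⁻¹ • Σ_i ∫ Φ_f(ω_i, e)·G_i(e) de‖ ≤ (512/π)·M_f·B`. -/
theorem klhs_slice_soft_signblind_norm_le (hbd : ∀ s, ‖f s‖ ≤ Mf) {n : ℕ}
    (hin : ∀ s, s ≤ (klScale klE0 n / 2) ^ 2 → f s = 0) (hout : ∀ s, (4 * klScale klE0 n) ^ 2 ≤ s → f s = 0)
    {M : ℕ} {β : ℝ} (hβ : klBetaMin ≤ β) (hn : n ≤ nScales β + 1) (m₀ : ℤ)
    {σ : MatsubaraIdx M → ℝ → ℝ} (hσ : ∀ i e e', |σ i e - σ i e'| ≤ |e - e'| / 2)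
    {G : MatsubaraIdx M → ℝ → ℂ} {B : ℝ} (hB : 0 ≤ B)
    (hG : ∀ i e, |e| < 4 * klScale klE0 n →
      ‖G i e‖ ≤ B / Real.sqrt ((Real.pi * (2 * ((matsubaraInt M i + m₀ : ℤ) : ℝ) + 1) / β) ^ 2 + (e + σ i e) ^ 2)) :
    ‖β⁻¹ • ∑ i : MatsubaraIdx M, ∫ e,
        (f (matsubaraFreq β M i ^ 2 + e ^ 2) / (((matsubaraFreq β M i ^ 2 + e ^ 2 : ℝ)) : ℂ) * (I * (matsubaraFreq β M i) + e)) * G i e‖ ≤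
      512 / Real.pi * Mf * B := by
  set Λ := klScale klE0 n with hΛdef
  have hΛ : 0 < Λ := klth_klScale_pos n
  have hβ0 : 0 < β := pos_of_klBetaMin_le hβ
  have hMf : 0 ≤ Mf := (norm_nonneg _).trans (hbd 0)
  have hr₁ : 0 < Λ / 2 := by positivity
  have hr : 0 < 4 * Λ := by positivity
  have hπ := Real.pi_pos
  -- partner frequencies
  set ν : MatsubaraIdx M → ℝ := fun i => Real.pi * (2 * ((matsubaraInt M i + m₀ : ℤ) : ℝ) + 1) / β with hνdef
  have hνabs : ∀ i, |ν i| = Real.pi / β * |2 * ((matsubaraInt M i + m₀ : ℤ) : ℝ) + 1| := by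
    intro i
    rw [hνdef]; dsimp only
    rw [mul_div_right_comm, abs_mul, abs_of_pos (div_pos hπ hβ0)]
  have hodd : ∀ i, (1 : ℝ) ≤ |2 * ((matsubaraInt M i + m₀ : ℤ) : ℝ) + 1| := by
    intro i
    have h : (1 : ℤ) ≤ |2 * (matsubaraInt M i + m₀) + 1| := by
      rcases le_or_gt 0 (matsubaraInt M i + m₀) with h0 | h0
      · rw [abs_of_nonneg (by omega)]; omega
      · rw [abs_of_neg (by omega)]; omega
    exact_mod_cast h
  have hν0 : ∀ i, ν i ≠ 0 := by
    intro i h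
    have := hνabs i
    rw [h, abs_zero] at this
    have h2 : 0 < Real.pi / β * |2 * ((matsubaraInt M i + m₀ : ℤ) : ℝ) + 1| := mul_pos (div_pos hπ hβ0) (by linarith [hodd i])
    linarith
  -- the slice propagator: sup and support
  have hgsupp : ∀ s, (4 * Λ) ^ 2 ≤ s → (fun s : ℝ => f s / ((s : ℝ) : ℂ)) s = 0 := fun s hs => by
    simp only [hout s hs, zero_div]
  have hΦbd : ∀ k₀ e : ℝ, ‖f (k₀ ^ 2 + e ^ 2) / (((k₀ ^ 2 + e ^ 2 : ℝ)) : ℂ) * (I * k₀ + e)‖ ≤ Mf / (Λ / 2) := fun k₀ e =>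
    klsp_div_propagator_norm_le hbd hin hr₁ k₀ e
  have hΦfst : ∀ k₀ : ℝ, 4 * Λ ≤ |k₀| → ∀ e : ℝ, f (k₀ ^ 2 + e ^ 2) / (((k₀ ^ 2 + e ^ 2 : ℝ)) : ℂ) * (I * k₀ + e) = 0 :=
    fun k₀ hk e => klsp_zero_of_le_abs_fst hgsupp hr.le hk e
  have hΦsnd : ∀ k₀ e : ℝ, 4 * Λ ≤ |e| → f (k₀ ^ 2 + e ^ 2) / (((k₀ ^ 2 + e ^ 2 : ℝ)) : ℂ) * (I * k₀ + e) = 0 :=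
    fun k₀ e he => klsp_zero_of_le_abs_snd hgsupp hr.le k₀ he
  -- per-frequency bound
  set c₁ : ℝ := Mf / (Λ / 2) * B with hc₁
  have hc₁0 : 0 ≤ c₁ := by positivity
  have hterm : ∀ i : MatsubaraIdx M,
      ‖∫ e, (f (matsubaraFreq β M i ^ 2 + e ^ 2) / (((matsubaraFreq β M i ^ 2 + e ^ 2 : ℝ)) : ℂ) *
          (I * (matsubaraFreq β M i) + e)) * G i e‖ ≤
        if |matsubaraFreq β M i| < 4 * Λ then c₁ * (8 * Real.sqrt 2 * Real.sqrt (4 * Λ) / Real.sqrt |ν i|) else 0 := by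
    intro i
    split_ifs with hi
    · have hσc : Continuous (σ i) := by
        refine Metric.continuous_iff.mpr fun e ε hε => ⟨ε, hε, fun e' he' => ?_⟩
        rw [Real.dist_eq] at he' ⊢
        linarith [hσ i e' e, abs_nonneg (e' - e)]
      have hbcont : Continuous fun e : ℝ => c₁ * (1 / Real.sqrt (ν i ^ 2 + (e + σ i e) ^ 2)) := by
        refine continuous_const.mul (continuous_const.div ((continuous_const.add ((continuous_id.add hσc).pow 2)).sqrt) fun e => ?_)
        exact ne_of_gt (Real.sqrt_pos.mpr (by positivity [hν0 i]))
      have hb0 : ∀ e, 0 ≤ c₁ * (1 / Real.sqrt (ν i ^ 2 + (e + σ i e) ^ 2)) := fun e => by positivity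
      refine (klhs_norm_integral_le_intervalIntegral hr.le hbcont hb0 (fun e he => ?_) (fun e he => ?_)).trans ?_
      · rw [norm_mul]
        have h1 := hΦbd (matsubaraFreq β M i) e
        have h2 := hG i e he
        calc ‖f (matsubaraFreq β M i ^ 2 + e ^ 2) / (((matsubaraFreq β M i ^ 2 + e ^ 2 : ℝ)) : ℂ) * (I * (matsubaraFreq β M i) + e)‖ *
              ‖G i e‖ ≤ Mf / (Λ / 2) * (B / Real.sqrt (ν i ^ 2 + (e + σ i e) ^ 2)) :=
              mul_le_mul h1 h2 (norm_nonneg _) (by positivity)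
          _ = c₁ * (1 / Real.sqrt (ν i ^ 2 + (e + σ i e) ^ 2)) := by rw [hc₁]; ring
      · rw [hΦsnd _ e he, zero_mul]
      · rw [intervalIntegral.integral_const_mul]
        exact mul_le_mul_of_nonneg_left (klhs_integral_inv_sqrt_shift_le (hν0 i) hr.le (hσ i)) hc₁0
    · simp_rw [hΦfst _ (not_lt.mp hi), zero_mul]
      rw [integral_zero, norm_zero]
  -- the frequency sum
  set S := Finset.univ.filter fun i : MatsubaraIdx M => |matsubaraFreq β M i| < 4 * Λ with hS
  have hcard : (S.card : ℝ) ≤ 4 * Λ * β / Real.pi + 3 :=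
    card_filter_matsubaraFreq_le hβ0 hr.le S (fun i hi => ((Finset.mem_filter.mp hi).2).le)
  have hinj : Set.InjOn (fun i : MatsubaraIdx M => matsubaraInt M i + m₀) S := by
    intro i _ j _ hij
    have h : matsubaraInt M i = matsubaraInt M j := add_right_cancel hij
    simp only [matsubaraInt] at h
    exact Fin.ext (by omega)
  have hsumν : ∑ i ∈ S, 1 / Real.sqrt |ν i| ≤ Real.sqrt (β / Real.pi) * (2 * Real.sqrt (2 * S.card)) := by
    have heq : ∀ i ∈ S, 1 / Real.sqrt |ν i| = Real.sqrt (β / Real.pi) * (1 / Real.sqrt |2 * ((matsubaraInt M i + m₀ : ℤ) : ℝ) + 1|) := by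
      intro i _
      rw [hνabs i, Real.sqrt_mul (div_pos hπ hβ0).le, Real.sqrt_div' Real.pi hβ0.le]
      have h1 : Real.sqrt Real.pi ≠ 0 := by positivity
      have h2 : Real.sqrt β ≠ 0 := by positivity
      have h3 : Real.sqrt |2 * ((matsubaraInt M i + m₀ : ℤ) : ℝ) + 1| ≠ 0 := by
        exact ne_of_gt (Real.sqrt_pos.mpr (by linarith [hodd i]))
      rw [Real.sqrt_div' β hπ.le]
      field_simp
    rw [Finset.sum_congr rfl heq, ← Finset.mul_sum]
    exact mul_le_mul_of_nonneg_left (klhs_sum_inv_sqrt_abs_odd_le S _ hinj) (Real.sqrt_nonneg _)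
  have hsum : ∑ i : MatsubaraIdx M, (if |matsubaraFreq β M i| < 4 * Λ then c₁ * (8 * Real.sqrt 2 * Real.sqrt (4 * Λ) / Real.sqrt |ν i|) else 0) =
      c₁ * (8 * Real.sqrt 2 * Real.sqrt (4 * Λ)) * ∑ i ∈ S, 1 / Real.sqrt |ν i| := by
    rw [← Finset.sum_filter, Finset.mul_sum]
    refine Finset.sum_congr rfl fun i _ => ?_
    ring
  -- numerics: `#S ≤ 4Λβ/π + 3`, `π/β ≤ 4Λ`
  have hmesh : Real.pi / β ≤ 4 * Λ := klte_pi_div_le_four_mul_klScale hβ hn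
  have hcard' : (2 * (S.card : ℝ)) ≤ 32 * Λ * β / Real.pi := by
    have h1 : Real.pi ≤ 4 * Λ * β := by rwa [div_le_iff₀ hβ0] at hmesh
    have h2 : (3 : ℝ) ≤ 12 * Λ * β / Real.pi := by rw [le_div_iff₀ hπ]; linarith
    have h3 : 32 * Λ * β / Real.pi = 2 * (4 * Λ * β / Real.pi) + 2 * (12 * Λ * β / Real.pi) := by ring
    rw [h3]
    linarith
  have hsqrt_card : Real.sqrt (2 * S.card) ≤ Real.sqrt (32 * Λ * β / Real.pi) := Real.sqrt_le_sqrt hcard'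
  calc ‖β⁻¹ • ∑ i : MatsubaraIdx M, ∫ e, (f (matsubaraFreq β M i ^ 2 + e ^ 2) /
          (((matsubaraFreq β M i ^ 2 + e ^ 2 : ℝ)) : ℂ) * (I * (matsubaraFreq β M i) + e)) * G i e‖
      = β⁻¹ * ‖∑ i : MatsubaraIdx M, ∫ e, (f (matsubaraFreq β M i ^ 2 + e ^ 2) /
          (((matsubaraFreq β M i ^ 2 + e ^ 2 : ℝ)) : ℂ) * (I * (matsubaraFreq β M i) + e)) * G i e‖ := by
        rw [norm_smul, norm_inv, Real.norm_of_nonneg hβ0.le]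
    _ ≤ β⁻¹ * ∑ i : MatsubaraIdx M, (if |matsubaraFreq β M i| < 4 * Λ then c₁ * (8 * Real.sqrt 2 * Real.sqrt (4 * Λ) / Real.sqrt |ν i|) else 0) :=
        mul_le_mul_of_nonneg_left ((norm_sum_le _ _).trans (Finset.sum_le_sum fun i _ => hterm i)) (inv_nonneg.mpr hβ0.le)
    _ = β⁻¹ * (c₁ * (8 * Real.sqrt 2 * Real.sqrt (4 * Λ)) * ∑ i ∈ S, 1 / Real.sqrt |ν i|) := by rw [hsum]
    _ ≤ β⁻¹ * (c₁ * (8 * Real.sqrt 2 * Real.sqrt (4 * Λ)) * (Real.sqrt (β / Real.pi) * (2 * Real.sqrt (32 * Λ * β / Real.pi)))) := by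
        gcongr
        exact hsumν.trans (mul_le_mul_of_nonneg_left (by linarith [hsqrt_card]) (Real.sqrt_nonneg _))
    _ = 512 / Real.pi * Mf * B := by
        -- `√2·√(4Λ)·√(β/π)·√(32Λβ/π) = √(2·4·32)·Λβ/π = 16Λβ/π`
        have hs4 : Real.sqrt (4 * Λ) = 2 * Real.sqrt Λ := by
          rw [Real.sqrt_mul (by norm_num), show Real.sqrt 4 = 2 by rw [show (4:ℝ) = 2^2 by norm_num, Real.sqrt_sq zero_le_two]]
        have hs32 : Real.sqrt (32 * Λ * β / Real.pi) = 4 * Real.sqrt 2 * Real.sqrt Λ * Real.sqrt (β / Real.pi) := by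
          rw [show 32 * Λ * β / Real.pi = (4 ^ 2 * 2) * Λ * (β / Real.pi) by ring]
          rw [Real.sqrt_mul (by positivity), Real.sqrt_mul (by positivity), Real.sqrt_mul (by positivity), Real.sqrt_sq (by norm_num)]
        rw [hs4, hs32, hc₁]
        have h2 : Real.sqrt 2 * Real.sqrt 2 = 2 := Real.mul_self_sqrt zero_le_two
        have hΛ' : Real.sqrt Λ * Real.sqrt Λ = Λ := Real.mul_self_sqrt hΛ.le
        have hβπ : Real.sqrt (β / Real.pi) * Real.sqrt (β / Real.pi) = β / Real.pi := Real.mul_self_sqrt (by positivity)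
        have e1 : β⁻¹ * (Mf / (Λ / 2) * B * (8 * Real.sqrt 2 * (2 * Real.sqrt Λ)) *
            (Real.sqrt (β / Real.pi) * (2 * (4 * Real.sqrt 2 * Real.sqrt Λ * Real.sqrt (β / Real.pi))))) =
            (β⁻¹ * (Mf / (Λ / 2) * B) * 128) *
              ((Real.sqrt 2 * Real.sqrt 2) * ((Real.sqrt Λ * Real.sqrt Λ) * (Real.sqrt (β / Real.pi) * Real.sqrt (β / Real.pi)))) := by
          ring
        rw [e1, h2, hΛ', hβπ]
        field_simp
        ring

/-- **Window form**: it suffices that each energy shift `σ_i` be `½`-Lipschitz ON THE WINDOW `[−4Λ_n, 4Λ_n]` (clamp `σ_i` outside; the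
integrand does not see the difference). -/
theorem klhs_slice_soft_signblind_norm_le_window (hbd : ∀ s, ‖f s‖ ≤ Mf) {n : ℕ}
    (hin : ∀ s, s ≤ (klScale klE0 n / 2) ^ 2 → f s = 0) (hout : ∀ s, (4 * klScale klE0 n) ^ 2 ≤ s → f s = 0)
    {M : ℕ} {β : ℝ} (hβ : klBetaMin ≤ β) (hn : n ≤ nScales β + 1) (m₀ : ℤ)
    {σ : MatsubaraIdx M → ℝ → ℝ}
    (hσ : ∀ i, ∀ e ∈ Set.Icc (-(4 * klScale klE0 n)) (4 * klScale klE0 n), ∀ e' ∈ Set.Icc (-(4 * klScale klE0 n)) (4 * klScale klE0 n),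
      |σ i e - σ i e'| ≤ |e - e'| / 2)
    {G : MatsubaraIdx M → ℝ → ℂ} {B : ℝ} (hB : 0 ≤ B)
    (hG : ∀ i e, |e| < 4 * klScale klE0 n →
      ‖G i e‖ ≤ B / Real.sqrt ((Real.pi * (2 * ((matsubaraInt M i + m₀ : ℤ) : ℝ) + 1) / β) ^ 2 + (e + σ i e) ^ 2)) :
    ‖β⁻¹ • ∑ i : MatsubaraIdx M, ∫ e,
        (f (matsubaraFreq β M i ^ 2 + e ^ 2) / (((matsubaraFreq β M i ^ 2 + e ^ 2 : ℝ)) : ℂ) * (I * (matsubaraFreq β M i) + e)) * G i e‖ ≤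
      512 / Real.pi * Mf * B := by
  set R := 4 * klScale klE0 n with hR
  have hR0 : 0 ≤ R := by have := klth_klScale_pos n; positivity
  have hmem : ∀ e : ℝ, max (-R) (min e R) ∈ Set.Icc (-R) R := fun e =>
    ⟨le_max_left _ _, max_le (by linarith) (min_le_right _ _)⟩
  refine klhs_slice_soft_signblind_norm_le hbd hin hout hβ hn m₀ (σ := fun i e => σ i (max (-R) (min e R)))
    (fun i e e' => ?_) hB (fun i e he => ?_)
  · exact (hσ i _ (hmem e) _ (hmem e')).trans (by linarith [klhs_clamp_lipschitz R e e'])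
  · rw [klhs_clamp_eq_self he]
    exact hG i e he

/-- **Large frequency transfer: DECAY `Λ_n/|q₀|`.**  Same data; if the bosonic transfer `q₀ = 2πm₀/β` satisfies `8Λ_n ≤ |q₀|`, then on the
first line's window `|ω_i| < 4Λ_n` the partner frequency obeys `|ν_i| ≥ |q₀|/2`, so `‖G_i‖ ≤ 2B/|q₀|` and the sup × count bound gives
`‖β⁻¹ • Σ_i ∫ Φ_f(ω_i,e)·G_i(e) de‖ ≤ (512/π)·M_f·B·(Λ_n/|q₀|)` — the frequency twin of the two-shell decay `a₁Λ/ρ` in the momentum transfer. -/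
theorem klhs_slice_soft_signblind_decay_le (hbd : ∀ s, ‖f s‖ ≤ Mf) {n : ℕ}
    (hin : ∀ s, s ≤ (klScale klE0 n / 2) ^ 2 → f s = 0) (hout : ∀ s, (4 * klScale klE0 n) ^ 2 ≤ s → f s = 0)
    {M : ℕ} {β : ℝ} (hβ : klBetaMin ≤ β) (hn : n ≤ nScales β + 1) (m₀ : ℤ)
    (hq : 8 * klScale klE0 n ≤ |2 * Real.pi * (m₀ : ℝ) / β|)
    {σ : MatsubaraIdx M → ℝ → ℝ}
    {G : MatsubaraIdx M → ℝ → ℂ} {B : ℝ} (hB : 0 ≤ B)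
    (hG : ∀ i e, |e| < 4 * klScale klE0 n →
      ‖G i e‖ ≤ B / Real.sqrt ((Real.pi * (2 * ((matsubaraInt M i + m₀ : ℤ) : ℝ) + 1) / β) ^ 2 + (e + σ i e) ^ 2)) :
    ‖β⁻¹ • ∑ i : MatsubaraIdx M, ∫ e,
        (f (matsubaraFreq β M i ^ 2 + e ^ 2) / (((matsubaraFreq β M i ^ 2 + e ^ 2 : ℝ)) : ℂ) * (I * (matsubaraFreq β M i) + e)) * G i e‖ ≤
      512 / Real.pi * Mf * B * (klScale klE0 n / |2 * Real.pi * (m₀ : ℝ) / β|) := by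
  set Λ := klScale klE0 n with hΛdef
  set q₀ : ℝ := 2 * Real.pi * (m₀ : ℝ) / β with hq₀
  have hΛ : 0 < Λ := klth_klScale_pos n
  have hβ0 : 0 < β := pos_of_klBetaMin_le hβ
  have hMf : 0 ≤ Mf := (norm_nonneg _).trans (hbd 0)
  have hr₁ : 0 < Λ / 2 := by positivity
  have hr : 0 < 4 * Λ := by positivity
  have hπ := Real.pi_pos
  have hq0 : 0 < |q₀| := lt_of_lt_of_le (by positivity) hq
  -- partner frequency `ν_i = ω_i + q₀`
  have hν : ∀ i : MatsubaraIdx M, Real.pi * (2 * ((matsubaraInt M i + m₀ : ℤ) : ℝ) + 1) / β = matsubaraFreq β M i + q₀ := by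
    intro i
    rw [matsubaraFreq, hq₀]; push_cast; ring
  -- the slice propagator
  have hgsupp : ∀ s, (4 * Λ) ^ 2 ≤ s → (fun s : ℝ => f s / ((s : ℝ) : ℂ)) s = 0 := fun s hs => by
    simp only [hout s hs, zero_div]
  have hΦbd : ∀ k₀ e : ℝ, ‖f (k₀ ^ 2 + e ^ 2) / (((k₀ ^ 2 + e ^ 2 : ℝ)) : ℂ) * (I * k₀ + e)‖ ≤ Mf / (Λ / 2) := fun k₀ e =>
    klsp_div_propagator_norm_le hbd hin hr₁ k₀ e
  have hΦfst : ∀ k₀ : ℝ, 4 * Λ ≤ |k₀| → ∀ e : ℝ, f (k₀ ^ 2 + e ^ 2) / (((k₀ ^ 2 + e ^ 2 : ℝ)) : ℂ) * (I * k₀ + e) = 0 :=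
    fun k₀ hk e => klsp_zero_of_le_abs_fst hgsupp hr.le hk e
  have hΦsnd : ∀ k₀ e : ℝ, 4 * Λ ≤ |e| → f (k₀ ^ 2 + e ^ 2) / (((k₀ ^ 2 + e ^ 2 : ℝ)) : ℂ) * (I * k₀ + e) = 0 :=
    fun k₀ e he => klsp_zero_of_le_abs_snd hgsupp hr.le k₀ he
  set c₂ : ℝ := Mf / (Λ / 2) * (2 * B / |q₀|) with hc₂
  have hc₂0 : 0 ≤ c₂ := by positivity
  have hterm : ∀ i : MatsubaraIdx M,
      ‖∫ e, (f (matsubaraFreq β M i ^ 2 + e ^ 2) / (((matsubaraFreq β M i ^ 2 + e ^ 2 : ℝ)) : ℂ) *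
          (I * (matsubaraFreq β M i) + e)) * G i e‖ ≤
        if |matsubaraFreq β M i| < 4 * Λ then 2 * (4 * Λ) * c₂ else 0 := by
    intro i
    split_ifs with hi
    · -- `|ν_i| ≥ |q₀|/2`
      have hνi : |q₀| / 2 ≤ |matsubaraFreq β M i + q₀| := by
        have h1 := abs_sub_abs_le_abs_sub q₀ (-matsubaraFreq β M i)
        rw [sub_neg_eq_add, abs_neg, add_comm] at h1
        linarith
      have hνpos : 0 < |matsubaraFreq β M i + q₀| := lt_of_lt_of_le (by positivity) hνi
      refine klsp_norm_integral_slice_le hr.le (fun e => ?_) (fun e he => ?_)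
      · by_cases he : |e| < 4 * Λ
        · rw [norm_mul]
          have h2 := hG i e he
          rw [hν i] at h2
          have h3 : B / Real.sqrt ((matsubaraFreq β M i + q₀) ^ 2 + (e + σ i e) ^ 2) ≤ 2 * B / |q₀| := by
            have hs : |matsubaraFreq β M i + q₀| ≤ Real.sqrt ((matsubaraFreq β M i + q₀) ^ 2 + (e + σ i e) ^ 2) := by
              rw [← Real.sqrt_sq_eq_abs]
              exact Real.sqrt_le_sqrt (by nlinarith [sq_nonneg (e + σ i e)])
            calc B / Real.sqrt ((matsubaraFreq β M i + q₀) ^ 2 + (e + σ i e) ^ 2) ≤ B / |matsubaraFreq β M i + q₀| :=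
                  div_le_div_of_nonneg_left hB hνpos hs
              _ ≤ B / (|q₀| / 2) := div_le_div_of_nonneg_left hB (by positivity) hνi
              _ = 2 * B / |q₀| := by field_simp
          exact mul_le_mul (hΦbd _ e) (h2.trans h3) (norm_nonneg _) (by positivity)
        · rw [hΦsnd _ e (not_lt.mp he), zero_mul, norm_zero]; exact hc₂0
      · rw [hΦsnd _ e he, zero_mul]
    · simp_rw [hΦfst _ (not_lt.mp hi), zero_mul]
      rw [integral_zero, norm_zero]
  have hcard := card_filter_matsubaraFreq_le hβ0 hr.le (Finset.univ.filter fun i : MatsubaraIdx M => |matsubaraFreq β M i| < 4 * Λ)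
    (fun i hi => ((Finset.mem_filter.mp hi).2).le)
  have hsum : ∑ i : MatsubaraIdx M, (if |matsubaraFreq β M i| < 4 * Λ then 2 * (4 * Λ) * c₂ else 0) =
      ((Finset.univ.filter fun i : MatsubaraIdx M => |matsubaraFreq β M i| < 4 * Λ).card : ℝ) * (2 * (4 * Λ) * c₂) := by
    rw [Finset.sum_ite, Finset.sum_const_zero, add_zero, Finset.sum_const, nsmul_eq_mul]
  have hcount := klsp_count_factor_le hβ hn
  rw [← hΛdef] at hcount
  calc ‖β⁻¹ • ∑ i : MatsubaraIdx M, ∫ e, (f (matsubaraFreq β M i ^ 2 + e ^ 2) /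
          (((matsubaraFreq β M i ^ 2 + e ^ 2 : ℝ)) : ℂ) * (I * (matsubaraFreq β M i) + e)) * G i e‖
      = β⁻¹ * ‖∑ i : MatsubaraIdx M, ∫ e, (f (matsubaraFreq β M i ^ 2 + e ^ 2) /
          (((matsubaraFreq β M i ^ 2 + e ^ 2 : ℝ)) : ℂ) * (I * (matsubaraFreq β M i) + e)) * G i e‖ := by
        rw [norm_smul, norm_inv, Real.norm_of_nonneg hβ0.le]
    _ ≤ β⁻¹ * ∑ i : MatsubaraIdx M, (if |matsubaraFreq β M i| < 4 * Λ then 2 * (4 * Λ) * c₂ else 0) :=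
        mul_le_mul_of_nonneg_left ((norm_sum_le _ _).trans (Finset.sum_le_sum fun i _ => hterm i)) (inv_nonneg.mpr hβ0.le)
    _ ≤ β⁻¹ * ((4 * Λ * β / Real.pi + 3) * (2 * (4 * Λ) * c₂)) := by
        rw [hsum]; exact mul_le_mul_of_nonneg_left (mul_le_mul_of_nonneg_right hcard (by positivity)) (inv_nonneg.mpr hβ0.le)
    _ = (4 * Λ / Real.pi + 3 / β) * (2 * (4 * Λ) * c₂) := by field_simp
    _ ≤ (16 / Real.pi * Λ) * (2 * (4 * Λ) * c₂) := mul_le_mul_of_nonneg_right hcount (by positivity)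
    _ = 512 / Real.pi * Mf * B * (Λ / |q₀|) := by rw [hc₂]; field_simp; ring

/-- **The frequency profile** (both regimes in one line): for `m₀ ≠ 0` the slice ⊗ soft sign-blind bubble is
`≤ (512/π)·M_f·B·min(1, 8Λ_n/|q₀|)`, `q₀ = 2πm₀/β` — `O(1)` up to `|q₀| ≍ Λ_n`, then decaying like `Λ_n/|q₀|`. -/
theorem klhs_slice_soft_signblind_profile_le (hbd : ∀ s, ‖f s‖ ≤ Mf) {n : ℕ}
    (hin : ∀ s, s ≤ (klScale klE0 n / 2) ^ 2 → f s = 0) (hout : ∀ s, (4 * klScale klE0 n) ^ 2 ≤ s → f s = 0)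
    {M : ℕ} {β : ℝ} (hβ : klBetaMin ≤ β) (hn : n ≤ nScales β + 1) {m₀ : ℤ} (hm₀ : m₀ ≠ 0)
    {σ : MatsubaraIdx M → ℝ → ℝ} (hσ : ∀ i e e', |σ i e - σ i e'| ≤ |e - e'| / 2)
    {G : MatsubaraIdx M → ℝ → ℂ} {B : ℝ} (hB : 0 ≤ B)
    (hG : ∀ i e, |e| < 4 * klScale klE0 n →
      ‖G i e‖ ≤ B / Real.sqrt ((Real.pi * (2 * ((matsubaraInt M i + m₀ : ℤ) : ℝ) + 1) / β) ^ 2 + (e + σ i e) ^ 2)) :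
    ‖β⁻¹ • ∑ i : MatsubaraIdx M, ∫ e,
        (f (matsubaraFreq β M i ^ 2 + e ^ 2) / (((matsubaraFreq β M i ^ 2 + e ^ 2 : ℝ)) : ℂ) * (I * (matsubaraFreq β M i) + e)) * G i e‖ ≤
      512 / Real.pi * Mf * B * min 1 (8 * klScale klE0 n / |2 * Real.pi * (m₀ : ℝ) / β|) := by
  have hΛ : 0 < klScale klE0 n := klth_klScale_pos n
  have hβ0 : 0 < β := pos_of_klBetaMin_le hβ
  have hMf : 0 ≤ Mf := (norm_nonneg _).trans (hbd 0)
  have hq0 : 0 < |2 * Real.pi * (m₀ : ℝ) / β| := by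
    have : (m₀ : ℝ) ≠ 0 := by exact_mod_cast hm₀
    positivity
  have hK : 0 ≤ 512 / Real.pi * Mf * B := by positivity
  rcases le_or_gt (8 * klScale klE0 n) |2 * Real.pi * (m₀ : ℝ) / β| with hq | hq
  · refine (klhs_slice_soft_signblind_decay_le hbd hin hout hβ hn m₀ hq hB hG).trans (mul_le_mul_of_nonneg_left ?_ hK)
    refine le_min ?_ ?_
    · rw [div_le_one hq0]; linarith
    · exact div_le_div_of_nonneg_right (by linarith) hq0.le
  · refine (klhs_slice_soft_signblind_norm_le hbd hin hout hβ hn m₀ hσ hB hG).trans ?_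
    have h1 : (1 : ℝ) ≤ 8 * klScale klE0 n / |2 * Real.pi * (m₀ : ℝ) / β| := by rw [le_div_iff₀ hq0]; linarith
    rw [min_eq_left h1]
    linarith

/-- **Reading `G_i = W_i·Ψ_i`** (vertex weight × soft propagator): with `‖W_i(e)‖ ≤ B_W` (`|e| < 4Λ_n`; the weight MAY depend on the loop
frequency) and a soft partner `‖Ψ_i(e)‖ ≤ M′/√(ν_i² + (e + σ_i(e))²)` (`|e| < 4Λ_n`; e.g. `Ψ_i(e) = (d(s′)/s′)·(iν_i + e′_i(e))`, `‖d‖ ≤ M′`,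
`s′ = ν_i² + e′_i(e)²`, `e′_i = e + σ_i(e)`): `‖β⁻¹ • Σ_i ∫ W_i(e)·Φ_f(ω_i,e)·Ψ_i(e) de‖ ≤ (512/π)·M_f·M′·B_W`. -/
theorem klhs_slice_soft_signblind_norm_le_mul (hbd : ∀ s, ‖f s‖ ≤ Mf) {n : ℕ}
    (hin : ∀ s, s ≤ (klScale klE0 n / 2) ^ 2 → f s = 0) (hout : ∀ s, (4 * klScale klE0 n) ^ 2 ≤ s → f s = 0)
    {M : ℕ} {β : ℝ} (hβ : klBetaMin ≤ β) (hn : n ≤ nScales β + 1) (m₀ : ℤ)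
    {σ : MatsubaraIdx M → ℝ → ℝ} (hσ : ∀ i e e', |σ i e - σ i e'| ≤ |e - e'| / 2)
    {W : MatsubaraIdx M → ℝ → ℂ} {BW : ℝ} (hBW : 0 ≤ BW) (hWbd : ∀ i e, |e| < 4 * klScale klE0 n → ‖W i e‖ ≤ BW)
    {Ψ : MatsubaraIdx M → ℝ → ℂ} {M' : ℝ} (hM' : 0 ≤ M')
    (hΨ : ∀ i e, |e| < 4 * klScale klE0 n →
      ‖Ψ i e‖ ≤ M' / Real.sqrt ((Real.pi * (2 * ((matsubaraInt M i + m₀ : ℤ) : ℝ) + 1) / β) ^ 2 + (e + σ i e) ^ 2)) :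
    ‖β⁻¹ • ∑ i : MatsubaraIdx M, ∫ e,
        W i e * (f (matsubaraFreq β M i ^ 2 + e ^ 2) / (((matsubaraFreq β M i ^ 2 + e ^ 2 : ℝ)) : ℂ) * (I * (matsubaraFreq β M i) + e)) *
          Ψ i e‖ ≤ 512 / Real.pi * Mf * M' * BW := by
  have hG : ∀ i e, |e| < 4 * klScale klE0 n →
      ‖W i e * Ψ i e‖ ≤ (BW * M') / Real.sqrt ((Real.pi * (2 * ((matsubaraInt M i + m₀ : ℤ) : ℝ) + 1) / β) ^ 2 + (e + σ i e) ^ 2) := by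
    intro i e he
    rw [norm_mul, mul_div_assoc]
    exact mul_le_mul (hWbd i e he) (hΨ i e he) (norm_nonneg _) hBW
  have h := klhs_slice_soft_signblind_norm_le hbd hin hout hβ hn m₀ hσ (G := fun i e => W i e * Ψ i e) (by positivity) hG
  have heq : (fun i : MatsubaraIdx M => ∫ e, W i e * (f (matsubaraFreq β M i ^ 2 + e ^ 2) /
      (((matsubaraFreq β M i ^ 2 + e ^ 2 : ℝ)) : ℂ) * (I * (matsubaraFreq β M i) + e)) * Ψ i e) =
      fun i => ∫ e, (f (matsubaraFreq β M i ^ 2 + e ^ 2) / (((matsubaraFreq β M i ^ 2 + e ^ 2 : ℝ)) : ℂ) *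
        (I * (matsubaraFreq β M i) + e)) * (W i e * Ψ i e) := by
    funext i; congr 1; funext e; ring
  rw [heq]
  refine h.trans (le_of_eq ?_)
  ring

end Model

end Summit.HubbardSuperconductivity.HubbardSuperconductivity.Theorems.KLRegimeSplit

end
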